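import Literature.MathematicalPhysics.QuantumFieldTheory.Balaban1983to89.B6SectAOntoV1
import Literature.MathematicalPhysics.QuantumFieldTheory.Balaban1983to89.B10StarCount
import HarnessLib

/-!
# BalabanUVNodes ∕ N12 — (J-b) module H1a: PRESCRIBING ONE LEVEL OF STRAIGHT BLOCK AVERAGES `Q = bondAvg` ON THE READING-(b) ROWS BY A FIELD ON SAFE BONDS —
# the corner-column lift (generalising lit-balaban p11's far-face `bondLift`) and the level step of the fine-to-coarse construction for [III] (2.2)∕(2.10)'s own index set

Cell `pub-ymgap` (HUMAN RULINGS D-0062 ∕ D-0149), width seat `pub-ymgap-dag-n10-w1` g3 (modules A–E, F, F′, G1, G2 of this lineage landed: `…N12FlatConstraintPlaquetteJunction`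
p592369 … `…N12GuardedLinAvgRightInverseGauge` p610869).  Key K1⁷ `stmt-QuantumFields-20542`, `--kind proof --supports … --as helper`; count-neutral; THEOREMS ONLY (0 `def`,
0 `sorry`, 0 `instance`, 0 `notation`).  This is WAY (ii) of the seat's located note (INBOX l.30547): the flat right inverse of the multi-scale constraint on r12's
READING-(b) index set — the `j`-bonds MEETING `Γ_j` (`B15DeterminingSets.bondsOf ∘ genSet`, `Node00.ConstrSet`), which contains, besides [Balaban1984PropagatorsII] (2.3)'s
`Λ_j = st(Ω_j)∖st(Ω_{j+1})` (lit-balaban p21's `BondIdx`, ONTO by `B6SectAOntoV1.exists_constr`), the level-`j` bonds joining `Γ_j` to the deep region `Ω_{j+1}`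
(`Node00/GenSetVsLamBond`).  p21's far-face construction cannot be re-run there: its level-`(n+1)` correction lives on the faces of `∂Ω_{n+1}`, inside the averaging boxes of
those crossing rows.  THIS FILE supplies the two-level step of a construction that CAN: every level-`(n+1)` target on the rows is the block average of a level-`n` field
supported on bonds with BOTH end blocks inside `Ω_{n+1}` (module H1b lifts it to the finest lattice, where it is invisible to every row of level `≤ n`, and runs the induction).

CONSUMED BY NAME, nothing modified: p11's `B5AveragingOnto.bondLift`∕`bondAvg_bondLift` (far-face right inverse of `Q`), p21's `B6SectAOntoV1.blockOf_shift_of_face`,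
p31's `BIJ85Eq219Proof.runSite_blockSite_of_lt∕_of_ge` + p27's `BIJ85CurlQsstar.blockOf_shift_blockSite` (the straight contour in block coordinates), p09's
`BIJ85AxialPropagator411.bondAvg_add`, the V1 calculus `LatticeFieldCalculus` (`bondAvg`, `segSum`, `runBond`), `TorusGeometry` (`Site.blockSite`, `val_blockSite`, `blockOf_blockSite`), `B10StarCount` (`shift_unshift`, `unshift_shift`).

CONTENTS.  §1 `val_blockSite_mod`, `runSite_apply_of_ne`, ★ `exists_colLift` — THE CORNER-COLUMN LIFT: for a column `a ≤ L − 2` the fine field carrying `B⟨y, μ⟩` on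
the ONE internal bond of `B(y)` issuing in the direction `μ` from the corner-line site with offsets `(r_μ, r_⊥) = (a, 0)`; its block average is
`(QZ)(c) = L^{−(d+1)}·((a+1)·B(c) + (L−1−a)·B(c⁺))` (`c⁺` the next bond: the straight contours from the `a + 1` corner-line sites of `B(c₋)` with `r_μ ≤ a` meet the
column inside `B(c₋)`, the other `L − 1 − a` meet it inside `B(c₊)`), and its support lies on internal bonds of blocks `y` with `B⟨y, ·⟩ ≠ 0`.
§2 ★★ `exists_bondAvg_eq_on_rows` — THE LEVEL STEP: given INSIDE blocks `In` and ROWS (each with an inside end-point), every target `R` on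
the rows is `(QZ)(c) = R(c)` for a level-`n` field `Z` whose supporting bonds have both end blocks inside: OUTER rows (one end outside) by the corner-column lifts at columns
`0` and `L − 2` of the inside block — the `μ`-isolated block gives the `2 × 2` system `α + (L−1)β = L^{d+1}R⁺`, `(L−1)α + β = L^{d+1}R⁻`, determinant `∝ 1 − (L−1)² ≠ 0`
(`L ≥ 3`, odd) — then the INNER rows (both ends inside; in particular reading (b)'s crossing rows) by p11's far-face lift of what remains, which leaks into no other row.

HONEST FRAMING.  Finite lattice combinatorics + linear algebra over `ℝ` on the tree's own straight averages; no estimate ((46)-type letters NOT claimed for reading (b)); nothing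
of Bałaban's analysis asserted; the ME #35 question (reading (b) vs (2.3)) is NOT adjudicated — the files only show the (b)-system is still solvable.  N12 ∕ N10 ∕ N07 NOT
discharged; K1⁷ NOT closed; count-neutral (typed 28∕28 · discharged 5∕27 unmoved); one finite 𝕋⁴ programme at fixed ε — R4 closes the conditional rung `BalabanLadder.UV`
only; the YM mass gap (Clay) is NOT proved by any of this; nothing continuum ∕ ℝ⁴ ∕ OS.
-/

noncomputable section

open scoped BigOperators

namespace Summit.QuantumFields.YangMills.BalabanUVNodes.N12FlatStraightOntoRows

open Literature.MathematicalPhysics.QuantumFieldTheory.Balaban1983to89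
open LatticeFieldCalculus B5AveragingOnto
open B10StarCount (shift_unshift unshift_shift)
open Literature.MathematicalPhysics.QuantumFieldTheory.BalabanImbrieJaffe1984to88.BIJ85AxialPropagator411 (bondAvg_add)
open Literature.MathematicalPhysics.QuantumFieldTheory.BalabanImbrieJaffe1984to88.BIJ85GaugeFunction5113 (exists_blockSite_eq)
open Literature.MathematicalPhysics.QuantumFieldTheory.BalabanImbrieJaffe1984to88.BIJ85CurlQsstar (blockOf_shift_blockSite)
open Literature.MathematicalPhysics.QuantumFieldTheory.BalabanImbrieJaffe1984to88.BIJ85Eq219Proof (runSite_blockSite_of_lt runSite_blockSite_of_ge)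

variable {P : Params}

/-! ## §1  The CORNER-COLUMN LIFT (generalising p11's far-face `bondLift`): value on ONE internal bond per block and direction -/

section ColumnLift

variable {j : ℕ}

/-- The label of `blockSite y r` in the direction `ν`, mod `L`, is the offset `r ν`. [folklore] -/
theorem val_blockSite_mod (hj : j + 1 ≤ P.m + P.K) (y : Site P (j + 1)) (r : Fin P.d → Fin P.L) (ν : Fin P.d) :
    ((Site.blockSite y r) ν).val % P.L = r ν := by
  rw [Site.val_blockSite hj, Nat.mul_add_mod', Nat.mod_eq_of_lt (r ν).isLt]

/-- Transverse coordinates do not move along a straight contour. [folklore] -/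
theorem runSite_apply_of_ne (x : Site P j) {μ ν : Fin P.d} (h : ν ≠ μ) (t : ℕ) : (runSite x μ t) ν = x ν := by
  simp only [runSite, Function.update_of_ne h]

/-- ★ **THE CORNER-COLUMN LIFT.**  For a column index `a ≤ L − 2` and a coarse bond field `B` on `T^{(j+1)}` there is a fine field `Z` on `T^{(j)}` carrying `B⟨y, μ⟩`
on the single INTERNAL bond `⟨x, x + e_μ⟩` of the block `B(y)` whose source `x` is the corner-line site with offsets `r_μ = a`, `r_ν = 0` (`ν ≠ μ`), and `0`
elsewhere; every straight contour `[x, x(c)]`, `x ∈ B(c₋)` on the corner line, meets the column `a` of `B(c₋)` iff `r_μ ≤ a` and otherwise the column `a` of `B(c₊)`,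
so `(QZ)(c) = L^{−(d+1)}·((a+1)·B(c) + (L−1−a)·B(c⁺))`, `c⁺ = ⟨c₊, μ⟩` the next bond; the support lies on internal bonds (`blockOf b₊ = blockOf b₋`) of blocks
`y` with `B⟨y, dir b⟩ ≠ 0`. (p11's `bondLift` is the far-face column `a = L − 1`, which leaks nothing into `c⁺`.) [cite: Balaban1984PropagatorsI, (1.11) p.19] -/
theorem exists_colLift (hj : j + 1 ≤ P.m + P.K) {a : ℕ} (ha : a + 2 ≤ P.L) (B : VecField P (j + 1) ℝ) :
    ∃ Z : VecField P j ℝ,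
      (∀ b : PBond P j, Z b ≠ 0 → B ⟨blockOf b.src, b.dir⟩ ≠ 0 ∧ blockOf b.tgt = blockOf b.src) ∧
      ∀ c : PBond P (j + 1), bondAvg Z c =
        (((P.L : ℝ) ^ (P.d + 1))⁻¹) * (((a : ℝ) + 1) * B c + ((P.L : ℝ) - 1 - a) * B ⟨c.tgt, c.dir⟩) := by
  classical
  have hL := P.hL.2
  -- the corner-line bond of column `a`
  let Z : VecField P j ℝ := fun b =>
    if (∀ ν : Fin P.d, (b.src ν).val % P.L = if ν = b.dir then a else 0) then B ⟨blockOf b.src, b.dir⟩ else 0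
  refine ⟨Z, fun b hb => ?_, fun c => ?_⟩
  · -- support
    have hcond : ∀ ν : Fin P.d, (b.src ν).val % P.L = if ν = b.dir then a else 0 := by
      by_contra h; exact hb (if_neg h)
    refine ⟨fun h0 => hb (by simp only [Z, if_pos hcond, h0]), ?_⟩
    obtain ⟨r, hr⟩ := exists_blockSite_eq hj b.src
    have hra : (r b.dir : ℕ) = a := by
      have := hcond b.dir
      rw [if_pos rfl, ← hr, val_blockSite_mod hj] at this
      exact this
    show blockOf (b.src.shift b.dir) = blockOf b.src
    conv_lhs => rw [← hr]
    rw [blockOf_shift_blockSite hj, if_neg (by omega)]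
  · -- the average
    have hLr : (P.L : ℝ) ≠ 0 := Nat.cast_ne_zero.mpr P.L_pos.ne'
    -- the contour sum from a block site
    have hseg : ∀ r : Fin P.d → Fin P.L, segSum Z (Site.blockSite c.src r) c.dir P.L =
        if (∀ ν, ν ≠ c.dir → (r ν : ℕ) = 0) then (if (r c.dir : ℕ) ≤ a then B c else B ⟨c.tgt, c.dir⟩) else 0 := by
      intro r
      -- value of `Z` on the `t`-th bond of the contour
      have hZt : ∀ t, t < P.L → Z (runBond (Site.blockSite c.src r) c.dir t) =
          if (∀ ν, ν ≠ c.dir → (r ν : ℕ) = 0) then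
            (if (r c.dir : ℕ) + t = a then B c else if (r c.dir : ℕ) + t = a + P.L then B ⟨c.tgt, c.dir⟩ else 0) else 0 := by
        intro t ht
        have htr : ∀ ν, ν ≠ c.dir → ((runSite (Site.blockSite c.src r) c.dir t) ν).val % P.L = r ν := fun ν hν => by
          rw [runSite_apply_of_ne _ hν, val_blockSite_mod hj]
        -- the `μ`-label mod `L` and the block of the contour site
        have hμ : ((runSite (Site.blockSite c.src r) c.dir t) c.dir).val % P.L = ((r c.dir : ℕ) + t) % P.L ∧
            blockOf (runSite (Site.blockSite c.src r) c.dir t) = (if (r c.dir : ℕ) + t < P.L then c.src else c.tgt) := by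
          by_cases hlt : (r c.dir : ℕ) + t < P.L
          · rw [runSite_blockSite_of_lt c.src r c.dir hlt]
            refine ⟨?_, ?_⟩
            · rw [val_blockSite_mod hj, Function.update_self, Nat.mod_eq_of_lt hlt]
            · rw [Site.blockOf_blockSite hj, if_pos hlt]
          · have hrL := (r c.dir).isLt
            rw [runSite_blockSite_of_ge hj c.src r c.dir (not_lt.1 hlt) (by omega)]
            refine ⟨?_, ?_⟩
            · rw [val_blockSite_mod hj, Function.update_self, Nat.mod_eq_sub_mod (not_lt.1 hlt), Nat.mod_eq_of_lt (by omega)]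
            · rw [Site.blockOf_blockSite hj, if_neg hlt]; rfl
        show (if (∀ ν : Fin P.d, ((runSite (Site.blockSite c.src r) c.dir t) ν).val % P.L = if ν = c.dir then a else 0) then
            B ⟨blockOf (runSite (Site.blockSite c.src r) c.dir t), c.dir⟩ else 0) = _
        by_cases hperp : ∀ ν, ν ≠ c.dir → (r ν : ℕ) = 0
        · rw [if_pos hperp]
          have hiff : (∀ ν : Fin P.d, ((runSite (Site.blockSite c.src r) c.dir t) ν).val % P.L = if ν = c.dir then a else 0) ↔
              ((r c.dir : ℕ) + t) % P.L = a := by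
            constructor
            · intro h; have := h c.dir; rw [if_pos rfl, hμ.1] at this; exact this
            · intro h ν
              by_cases hν : ν = c.dir
              · subst hν; rw [if_pos rfl, hμ.1, h]
              · rw [if_neg hν, htr ν hν, hperp ν hν]
          simp only [hiff, hμ.2]
          have hrlt := (r c.dir).isLt
          by_cases h1 : (r c.dir : ℕ) + t = a
          · rw [if_pos (by rw [h1]; exact Nat.mod_eq_of_lt (by omega)), if_pos (by omega), if_pos h1]
          · rw [if_neg h1]
            by_cases h2 : (r c.dir : ℕ) + t = a + P.L
            · rw [if_pos (by rw [h2, Nat.add_mod_right]; exact Nat.mod_eq_of_lt (by omega)), if_neg (by omega), if_pos h2]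
            · rw [if_neg h2, if_neg]
              intro h
              rcases lt_or_ge ((r c.dir : ℕ) + t) P.L with hl | hl
              · rw [Nat.mod_eq_of_lt hl] at h; exact h1 h
              · rw [Nat.mod_eq_sub_mod hl, Nat.mod_eq_of_lt (by omega)] at h; omega
        · rw [if_neg hperp, if_neg]
          intro h
          apply hperp
          intro ν hν
          have := h ν
          rw [if_neg hν, htr ν hν] at this
          exact this
      -- sum along the contour: exactly one bond carries the value
      unfold segSum
      by_cases hperp : ∀ ν, ν ≠ c.dir → (r ν : ℕ) = 0
      · rw [if_pos hperp]
        have hrlt := (r c.dir).isLt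
        by_cases hle : (r c.dir : ℕ) ≤ a
        · rw [if_pos hle, Finset.sum_eq_single_of_mem (a - (r c.dir : ℕ)) (Finset.mem_range.mpr (by omega))]
          · rw [hZt _ (by omega), if_pos hperp, if_pos (by omega)]
          · intro t ht hne
            rw [hZt _ (Finset.mem_range.mp ht), if_pos hperp, if_neg (by omega), if_neg (by have := Finset.mem_range.mp ht; omega)]
        · rw [if_neg hle, Finset.sum_eq_single_of_mem (a + P.L - (r c.dir : ℕ)) (Finset.mem_range.mpr (by omega))]
          · rw [hZt _ (by omega), if_pos hperp, if_neg (by omega), if_pos (by omega)]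
          · intro t ht hne
            rw [hZt _ (Finset.mem_range.mp ht), if_pos hperp, if_neg (by omega), if_neg (by have := Finset.mem_range.mp ht; omega)]
      · rw [if_neg hperp]
        exact Finset.sum_eq_zero fun t ht => by rw [hZt _ (Finset.mem_range.mp ht), if_neg hperp]
    -- sum over the block offsets: only the corner line `r_ν = 0 (ν ≠ μ)` contributes, indexed by `i = r_μ`
    unfold bondAvg
    simp only [hseg, smul_eq_mul]
    congr 1
    let ι : Fin P.L → (Fin P.d → Fin P.L) := fun i => Function.update (fun _ => ⟨0, P.L_pos⟩) c.dir i
    have hι : Function.Injective ι := fun i i' h => by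
      have := congrFun h c.dir; simpa [ι] using this
    rw [← Finset.sum_subset (Finset.subset_univ (Finset.univ.image ι)), Finset.sum_image fun i _ i' _ h => hι h]
    · have hi : ∀ i : Fin P.L, (∀ ν, ν ≠ c.dir → ((ι i) ν : ℕ) = 0) := fun i ν hν => by simp [ι, Function.update_of_ne hν]
      simp only [if_pos (hi _)]
      have hι' : ∀ i : Fin P.L, ((ι i) c.dir : ℕ) = i := fun i => by simp [ι]
      simp only [hι']
      -- `#{i ≤ a} = a + 1`
      let i₀ : Fin P.L := ⟨a, by omega⟩
      have hcount : ∑ i : Fin P.L, (if (i : ℕ) ≤ a then B c else B ⟨c.tgt, c.dir⟩) =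
          ((a : ℝ) + 1) * B c + ((P.L : ℝ) - 1 - a) * B ⟨c.tgt, c.dir⟩ := by
        have h1 : ∀ i : Fin P.L, (if (i : ℕ) ≤ a then B c else B ⟨c.tgt, c.dir⟩) =
            B ⟨c.tgt, c.dir⟩ + (if i ∈ Finset.Iic i₀ then B c - B ⟨c.tgt, c.dir⟩ else 0) := by
          intro i
          have : ((i : ℕ) ≤ a) ↔ i ∈ Finset.Iic i₀ := by rw [Finset.mem_Iic]; exact Iff.rfl
          by_cases h : (i : ℕ) ≤ a
          · rw [if_pos h, if_pos (this.1 h)]; ring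
          · rw [if_neg h, if_neg (fun h' => h (this.2 h'))]; ring
        simp_rw [h1]
        rw [Finset.sum_add_distrib, Finset.sum_const, Finset.card_univ, Fintype.card_fin, Finset.sum_ite_mem, Finset.univ_inter,
          Finset.sum_const, Fin.card_Iic, nsmul_eq_mul, nsmul_eq_mul]
        simp only [i₀]
        push_cast
        ring
      exact hcount
    · intro r _ hr
      rw [if_neg]
      intro h
      apply hr
      refine Finset.mem_image.mpr ⟨r c.dir, Finset.mem_univ _, funext fun ν => ?_⟩
      by_cases hν : ν = c.dir
      · subst hν; simp [ι]
      · simp only [ι, Function.update_of_ne hν]; exact Fin.ext (h ν hν).symm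

end ColumnLift

/-! ## §2  One level up: prescribing the block averages on the READING-(b) ROWS by a field supported on SAFE bonds (both end blocks inside) -/

section Step

variable {n : ℕ}

/-- ★★ **THE LEVEL STEP.**  Blocks `W` of `T^{(n+1)}` are marked INSIDE (`In W`) or not, and a set of level-`(n+1)` bonds (the ROWS) is given, each row having an inside
end-point.  Then every target `R` on the rows is the block average `(QZ)(c) = R(c)` of a level-`n` field `Z` supported on bonds whose two end blocks are inside:
OUTER rows (one end-point outside) are met by the corner-column lifts of §1 at the columns `0` and `L − 2` of the inside block — for a block isolated in the direction `μ`
(both `⟨W − e_μ, W⟩` and `⟨W, W + e_μ⟩` outer) the `2 × 2` system has determinant `L^{2(d+1)}·(1 − (L−1)²) ≠ 0`, `L ≥ 3` — and then the INNER rows (both end-points inside,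
in particular the `Γ → deep` crossing rows of reading (b)) by p11's far-face lift of the remaining residual, which leaks into no other row.
[cite: Balaban1984PropagatorsI, (1.11) p.19; Balaban1988Convergent, (2.2) p.255, (2.10) p.256] -/
theorem exists_bondAvg_eq_on_rows (hn : n + 1 ≤ P.m + P.K) (In : Site P (n + 1) → Prop) (Row : PBond P (n + 1) → Prop)
    (hRow : ∀ c, Row c → In c.src ∨ In c.tgt) (R : VecField P (n + 1) ℝ) :
    ∃ Z : VecField P n ℝ, (∀ c, Row c → bondAvg Z c = R c) ∧ ∀ e : PBond P n, Z e ≠ 0 → In (blockOf e.src) ∧ In (blockOf e.tgt) := by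
  classical
  have hL3 : 3 ≤ P.L := by have := P.hL.2; obtain ⟨t, ht⟩ := P.hL.1; omega
  have hLr : (P.L : ℝ) ≠ 0 := Nat.cast_ne_zero.mpr P.L_pos.ne'
  have hL2r : (P.L : ℝ) - 2 ≠ 0 := by
    have : (3 : ℝ) ≤ P.L := by exact_mod_cast hL3
    intro h; linarith
  set s : ℝ := (P.L : ℝ) ^ (P.d + 1) with hs
  have hs0 : s ≠ 0 := pow_ne_zero _ hLr
  -- the previous ∕ next bond along the direction
  let prev : PBond P (n + 1) → PBond P (n + 1) := fun c => ⟨c.src.unshift c.dir, c.dir⟩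
  let next : PBond P (n + 1) → PBond P (n + 1) := fun c => ⟨c.tgt, c.dir⟩
  have prev_next : ∀ c, prev (next c) = c := fun c => by
    cases c with
    | mk x μ => simp only [prev, next, PBond.tgt, unshift_shift]
  have next_src : ∀ c, (next c).src = c.tgt := fun _ => rfl
    -- outer rows keyed at their inside block: `oP c` = `c` outer with inside source; `oM c` = `prev c` outer with inside target `c.src`
  let oP : PBond P (n + 1) → Prop := fun c => Row c ∧ In c.src ∧ ¬ In c.tgt
  let oM : PBond P (n + 1) → Prop := fun c => Row (prev c) ∧ In c.src ∧ ¬ In (prev c).src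
  let α : VecField P (n + 1) ℝ := fun c =>
    if oP c then (if oM c then s * (((P.L : ℝ) - 1) * R (prev c) - R c) / ((P.L : ℝ) * ((P.L : ℝ) - 2)) else s * R c) else 0
  let β : VecField P (n + 1) ℝ := fun c =>
    if oM c then (if oP c then s * (((P.L : ℝ) - 1) * R c - R (prev c)) / ((P.L : ℝ) * ((P.L : ℝ) - 2)) else s * R (prev c)) else 0
  obtain ⟨Z₀, hZ₀s, hZ₀⟩ := exists_colLift hn (a := 0) (by omega) α
  obtain ⟨Z₁, hZ₁s, hZ₁⟩ := exists_colLift hn (a := P.L - 2) (by omega) β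
  -- the inner rows and the far-face lift of the remaining residual
  let inner : PBond P (n + 1) → Prop := fun c => Row c ∧ In c.src ∧ In c.tgt
  let R' : VecField P (n + 1) ℝ := fun c => if inner c then R c - (bondAvg Z₀ c + bondAvg Z₁ c) else 0
  refine ⟨Z₀ + Z₁ + bondLift R', fun c hc => ?_, fun e he => ?_⟩
  · -- the rows
    rw [bondAvg_add, bondAvg_add, bondAvg_bondLift hn, Pi.add_apply, Pi.add_apply, hZ₀ c, hZ₁ c]
    have hcast : (((P.L - 2 : ℕ) : ℝ)) = (P.L : ℝ) - 2 := by rw [Nat.cast_sub (by omega)]; norm_num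
    simp only [Nat.cast_zero, zero_add, hcast]
    by_cases hs_ : In c.src <;> by_cases ht_ : In c.tgt
    · -- inner row
      have hin : inner c := ⟨hc, hs_, ht_⟩
      simp only [R', if_pos hin, hZ₀ c, hZ₁ c, Nat.cast_zero, zero_add, hcast]
      ring
    · -- outer, inside source
      have hoP : oP c := ⟨hc, hs_, ht_⟩
      have hin : ¬ inner c := fun h => ht_ h.2.2
      have hαn : α (next c) = 0 := by
        have : ¬ oP (next c) := fun h => ht_ h.2.1
        simp only [α, if_neg this]
      have hβn : β (next c) = 0 := by
        have : ¬ oM (next c) := fun h => ht_ h.2.1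
        simp only [β, if_neg this]
      rw [show (⟨c.tgt, c.dir⟩ : PBond P (n + 1)) = next c from rfl, hαn, hβn]
      simp only [R', if_neg hin]
      by_cases hoM : oM c
      · simp only [α, β, if_pos hoP, if_pos hoM]
        field_simp
        ring
      · simp only [α, β, if_pos hoP, if_neg hoM]
        field_simp
        ring
    · -- outer, inside target: keyed at the block `c.tgt`, i.e. at the bond `next c`
      have hoM : oM (next c) := by
        refine ⟨?_, ht_, ?_⟩
        · rw [prev_next]; exact hc
        · rw [prev_next]; exact hs_
      have hin : ¬ inner c := fun h => hs_ h.2.1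
      have hα : α c = 0 := by
        have : ¬ oP c := fun h => hs_ h.2.1
        simp only [α, if_neg this]
      have hβ : β c = 0 := by
        have : ¬ oM c := fun h => hs_ h.2.1
        simp only [β, if_neg this]
      rw [show (⟨c.tgt, c.dir⟩ : PBond P (n + 1)) = next c from rfl, hα, hβ]
      simp only [R', if_neg hin]
      by_cases hoP : oP (next c)
      · simp only [α, β, if_pos hoP, if_pos hoM, prev_next]
        field_simp
        ring
      · simp only [α, β, if_neg hoP, if_pos hoM, prev_next]
        field_simp
        ring
    · exact absurd (hRow c hc) (by tauto)
  · -- the support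
    have hbl : ∀ c, bondLift R' c ≠ 0 → In (blockOf c.src) ∧ In (blockOf c.tgt) := by
      intro b hb
      unfold bondLift at hb
      by_cases hface : (b.src b.dir).val % P.L = P.L - 1
      · rw [if_pos hface] at hb
        have hR' : R' ⟨blockOf b.src, b.dir⟩ ≠ 0 := fun h => hb (by rw [h, mul_zero])
        have hin : inner ⟨blockOf b.src, b.dir⟩ := by
          by_contra h; exact hR' (by simp only [R', if_neg h])
        refine ⟨hin.2.1, ?_⟩
        have : blockOf b.tgt = (blockOf b.src).shift b.dir := B6SectAOntoV1.blockOf_shift_of_face hn b.src b.dir hface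
        rw [this]; exact hin.2.2
      · exact absurd (by rw [if_neg hface]) hb
    have h0 : ∀ b, Z₀ b ≠ 0 → In (blockOf b.src) ∧ In (blockOf b.tgt) := by
      intro b hb
      obtain ⟨hαb, hbt⟩ := hZ₀s b hb
      have : oP ⟨blockOf b.src, b.dir⟩ := by by_contra h; exact hαb (by simp only [α, if_neg h])
      rw [hbt]; exact ⟨this.2.1, this.2.1⟩
    have h1 : ∀ b, Z₁ b ≠ 0 → In (blockOf b.src) ∧ In (blockOf b.tgt) := by
      intro b hb
      obtain ⟨hβb, hbt⟩ := hZ₁s b hb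
      have : oM ⟨blockOf b.src, b.dir⟩ := by by_contra h; exact hβb (by simp only [β, if_neg h])
      rw [hbt]; exact ⟨this.2.1, this.2.1⟩
    by_cases hb0 : Z₀ e ≠ 0
    · exact h0 e hb0
    by_cases hb1 : Z₁ e ≠ 0
    · exact h1 e hb1
    by_cases hb2 : bondLift R' e ≠ 0
    · exact hbl e hb2
    exfalso; apply he
    simp only [Pi.add_apply, not_not.1 hb0, not_not.1 hb1, not_not.1 hb2, add_zero]

end Step


end Summit.QuantumFields.YangMills.BalabanUVNodes.N12FlatStraightOntoRows

end
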